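import Summits.BirchSwinnertonDyer.BirchSwinnertonDyer.Theorems.GenusKolyvaginAtTwoShaCardDvdPowAtTwoRTRestrictionKernelNontrivial
import Summits.BirchSwinnertonDyer.BirchSwinnertonDyer.Theorems.GenusKolyvaginAtTwoShaCardDvdPowAtTwoRTShaFiniteAtTwo
import HarnessLib

/-!
# Route `GenusKolyvaginAtTwo`, crux U_T `ShaCardDvdPowAtTwoRT` (stmt-BirchSwinnertonDyer-23658), LINE 19 `rational_pair_descent`,
# stub SANDWICH′ — THE ASSEMBLY: `2 · #Ш(E/K)[2^∞] ≤ A · B` from the relaxed-index bound `#res⁻¹(Ш_K[2^∞]) ≤ A` and the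
# anti-symmetrisation bound `#(1 − τ)Ш_K[2^∞] ≤ B` (the two remaining displayed inputs), on U_T's frame with `w(E) = 1`

Seat `bsd-line-gk2-p1` g19 (LEAD, cell `bsd-f1-sign2`), `--supports stmt-BirchSwinnertonDyer-23658` (helper; closes nothing).
THEOREMS ONLY (no definition, no named fact, no `sorry`).  BSD is NOT proved by any of this; U_T is not proved; `stub_sandwichOfMinimalTwin` is
NOT closed by this file (its two inputs `hR`, `hA` are displayed hypotheses — memo `Lines/rational-pair-descent-lead-g19.md` §6c (R), (A)).

THE COUNT.  `X := Ш(E/K)[2^∞] ⊆ H¹(K, E_K)` (finite: gk2-p5 g29 `finite_primaryComponent_sha_two_onHabitat`), `τ_*` the action of the chosen lift of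
`σ`, `res = resBaseChange W K`, `R := res⁻¹(X) ⊆ H¹(ℚ, E)`.  Then `#X = #X^τ · #(1 − τ_*)X` (first isomorphism theorem for `1 − τ_*` on `X`);
`X^τ ⊆ res(R)` (this seat's `exists_resBaseChange_eq_of_conjH1Points_eq_onHabitat`: invariant classes are restrictions on the frame);
`#res(R) = #R / #ker(res|_R)` and `ker(res) ⊆ R` has at least two elements (this seat's Kramer class `exists_ne_zero_resBaseChange_eq_zero_onHabitat`);
hence **`2 · #X ≤ #R · #(1 − τ_*)X ≤ A · B`**.  With the memo's values `A = #Ш(E/ℚ)[2^∞] · 2^DEF` (relaxed index) and `B = 2^DEF`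
(`Ш(Wd/ℚ)[2^∞] = 0` for the minimal twin), `DEF = 1`: `#X ≤ 2 · #Ш(E/ℚ)[2^∞]` = `stub_sandwichOfMinimalTwin`.

* `two_mul_natCard_sha_le_of_inputs` — the assembly, inputs `hR`, `hA` displayed (abstract bounds `A`, `B`).
* `natCard_sha_dvd_two_mul_of_inputs` — the numerical closer: with `A = #Ш(E/ℚ)[2^∞]·2^e`, `B = 2^e`, `e ≤ 1`, the conclusion of
  `stub_sandwichOfMinimalTwin` verbatim (`#Ш(E/K)[2^∞] ∣ 2·#Ш(E/ℚ)[2^∞]`).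

References: [Kramer1981] Thm. 1, proof of Thm. 2; [GrossLMS1991] §5 (5.1)–(5.3); [SerreGaloisCohomology1997] I §2.6 (b), I §5.8.
-/

set_option autoImplicit false
set_option linter.dupNamespace false

noncomputable section

open scoped Classical

namespace Summit.BirchSwinnertonDyer.BirchSwinnertonDyer.Theorems.GenusExact.PlusDescent

open Literature.NumberTheory.EllipticCurves Literature.NumberTheory.GaloisRepresentations WeierstrassCurve NumberField
  IsDedekindDomain Field Literature.NumberTheory.EllipticCurves.ModularForms AddSubgroup
open Summit.BirchSwinnertonDyer.BirchSwinnertonDyer.Theses.GenusKolyvaginAtTwo (KolyvaginRelationAtTwo)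

/-! ## Generic counting: first isomorphism theorem in `Nat.card` form -/

section Counting

variable {G H : Type*} [AddCommGroup G] [AddCommGroup H]

/-- `#S = #ker(f|_S) · #f(S)` for a subgroup `S` and a homomorphism `f` (first isomorphism theorem + Lagrange, `Nat.card` form).
[folklore] -/
theorem natCard_eq_natCard_ker_mul_natCard_map (S : AddSubgroup G) (f : G →+ H) :
    Nat.card S = Nat.card (f.comp S.subtype).ker * Nat.card (S.map f) := by
  rw [AddSubgroup.card_eq_card_quotient_mul_card_addSubgroup (f.comp S.subtype).ker, mul_comm,
    Nat.card_congr (QuotientAddGroup.quotientKerEquivRange (f.comp S.subtype)).toEquiv, AddMonoidHom.range_comp,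
    AddSubgroup.range_subtype]

end Counting

/-! ## The assembly on U_T's frame -/

section Assembly

variable (W : WeierstrassCurve ℚ) [W.IsElliptic] [W.IsGloballyMinimal] [NeZero (W.conductorNorm ℤ)]
variable (K : Type) [Field K] [NumberField K]

/-- **SANDWICH′ ASSEMBLY.**  On U_T's frame (rev-37 binders; only `hndiv` of the `M₀`-clause used) with `W.rootNumber = 1`, for the
non-trivial `σ ∈ Aut(K/ℚ)` with chosen lift `τ`: writing `X = Ш(E/K)[2^∞] ≤ H¹(K, E_K)` (as a subgroup of `galH1`), if
`#res⁻¹(X) ≤ A` (the relaxed-index input) and `#(1 − τ_*)(X) ≤ B` (the anti-symmetrisation input), then **`2 · #Ш(E/K)[2^∞] ≤ A · B`**.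
[cite: Kramer1981, Thm. 1 and proof of Thm. 2] [cite: GrossLMS1991, §5 (5.1)–(5.3)] [cite: SerreGaloisCohomology1997, I §5.8] -/
theorem two_mul_natCard_sha_le_of_inputs (hQ2 : KolyvaginRelationAtTwo) (hcm : ¬ W.HasCM)
    (hT : Odd W.tamagawaProduct) (v : HeightOneSpectrum (𝓞 ℚ)) (h2v : ((2 : ℕ) : 𝓞 ℚ) ∉ v.asIdeal)
    (hNv : ((W.conductorNorm ℤ : ℕ) : 𝓞 ℚ) ∈ v.asIdeal) (hmult : W.HasMultiplicativeReductionAt v) (hneg : W.Δ < 0)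
    (hIQ : IsImaginaryQuadratic K) (hodd : Odd (NumberField.discr K))
    (h3 : NumberField.discr K ≠ -3) (hHe : SatisfiesHeegnerHypothesis (W.conductorNorm ℤ) K)
    (hsq1 : ¬ IsSquare ((NumberField.discr K : ℚ) * -|W.Δ|)) (hsq2 : ¬ IsSquare ((NumberField.discr K : ℚ) * (-(2 * |W.Δ|))))
    (hρ : ∀ n : ℕ, 0 < n → W.HasSurjectiveModNGaloisRep ((2 : ℤ) ^ n))
    (Dt : ModularParametrizationData W (W.conductorNorm ℤ)) (β : ℤ) (ι : K →+* ℂ) (d₁ : KolyvaginHeegnerData Dt β ι 1) (M₀ : ℕ)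
    (hndiv : ¬ ∃ Q : (W.baseChange (ringClassField K ι 1)).toAffine.Point, ((2 ^ (M₀ + 1) : ℕ) : ℤ) • Q = d₁.derivedPoint)
    (hw : W.rootNumber = 1) {σ : K ≃ₐ[ℚ] K} (hσ1 : σ ≠ 1) (A B : ℕ)
    (hR : Nat.card (((AddCommGroup.primaryComponent (↥(W.baseChange K).sha) 2).map (W.baseChange K).sha.subtype).comap
      (resBaseChange W K)) ≤ A)
    (hA : Nat.card (((AddCommGroup.primaryComponent (↥(W.baseChange K).sha) 2).map (W.baseChange K).sha.subtype).map
      (AddMonoidHom.id (W.baseChange K).galH1 - (isLiftOfAut_liftAut σ).conjH1Points W)) ≤ B) :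
    2 * Nat.card (AddCommGroup.primaryComponent (↥(W.baseChange K).sha) 2) ≤ A * B := by
  haveI : Fact (Nat.Prime 2) := ⟨Nat.prime_two⟩
  -- ### the objects
  set X : AddSubgroup ↥(W.baseChange K).sha := AddCommGroup.primaryComponent (↥(W.baseChange K).sha) 2 with hX
  set Xs : AddSubgroup (W.baseChange K).galH1 := X.map (W.baseChange K).sha.subtype with hXs
  set res := resBaseChange W K with hres
  set τs := (isLiftOfAut_liftAut σ).conjH1Points W with hτs
  set δ : (W.baseChange K).galH1 →+ (W.baseChange K).galH1 := AddMonoidHom.id _ - τs with hδ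
  set R : AddSubgroup W.galH1 := Xs.comap res with hRdef
  -- ### finiteness of `X`, `Xs`
  haveI hXfin : Finite X :=
    finite_primaryComponent_sha_two_onHabitat hQ2 W hcm hT v h2v hNv hmult hneg K hIQ hodd h3 hHe hsq1 hsq2 hρ Dt β ι d₁ M₀ hndiv
  haveI hXsfin : Finite Xs := by
    have h : (Xs : Set (W.baseChange K).galH1).Finite := by
      rw [hXs, AddSubgroup.coe_map]
      exact (Set.toFinite _).image _
    exact h.to_subtype
  have hcardXs : Nat.card Xs = Nat.card X :=
    (Nat.card_congr (X.equivMapOfInjective (W.baseChange K).sha.subtype (W.baseChange K).sha.subtype_injective).toEquiv).symm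
  -- ### `#Xs = #ker(δ|_Xs) · #δ(Xs)`
  have hsplit := natCard_eq_natCard_ker_mul_natCard_map Xs δ
  -- ### `R` is finite: `ker(res|_R)` is finite (the local kernel at `K`) and `res(R) ⊆ Xs`
  have hmaple : R.map res ≤ Xs := AddSubgroup.map_comap_le _ _
  haveI hRmapfin : Finite (R.map res) := Finite.of_injective (AddSubgroup.inclusion hmaple) (AddSubgroup.inclusion_injective hmaple)
  have hkerfin : (res.ker : Set W.galH1).Finite := by
    have h := finite_localRestrictionKer_numberField W K
    refine h.subset fun c hc ↦ ?_
    exact (mem_ker_resBaseChange_iff W K c).mp ((AddMonoidHom.mem_ker).mp hc)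
  haveI : Finite res.ker := hkerfin.to_subtype
  set ρ : R →+ (W.baseChange K).galH1 := res.comp R.subtype with hρdef
  haveI hρkerfin : Finite ρ.ker := by
    refine Finite.of_injective (fun k : ρ.ker ↦ (⟨((k : R) : W.galH1), ?_⟩ : res.ker)) ?_
    · exact (AddMonoidHom.mem_ker).mpr ((AddMonoidHom.mem_ker).mp k.2)
    · intro k₁ k₂ h
      apply Subtype.ext
      apply Subtype.ext
      exact congrArg (fun z : res.ker ↦ (z : W.galH1)) h
  have hρrange : ρ.range = R.map res := by rw [hρdef, AddMonoidHom.range_comp, AddSubgroup.range_subtype]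
  haveI hρrangefin : Finite ρ.range := by rw [hρrange]; exact hRmapfin
  haveI hRfin : Finite R := (AddMonoidHom.finite_iff_finite_ker_range ρ).mpr ⟨hρkerfin, hρrangefin⟩
  -- ### `#R = #ker(ρ) · #res(R)` with `#ker(ρ) ≥ 2` (the Kramer class)
  have hRsplit : Nat.card R = Nat.card ρ.ker * Nat.card (R.map res) := natCard_eq_natCard_ker_mul_natCard_map R res
  obtain ⟨η, hη0, hηres⟩ := exists_ne_zero_resBaseChange_eq_zero_onHabitat W K hQ2 hcm hT v h2v hNv hmult hneg hIQ hodd h3 hHe hsq1 hsq2 hρ Dt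
    β ι d₁ M₀ hndiv hw
  have hηR : η ∈ R := by
    rw [hRdef, AddSubgroup.mem_comap]
    have h0 : res η = 0 := hηres
    rw [h0]
    exact Xs.zero_mem
  have hker2 : 2 ≤ Nat.card ρ.ker := by
    have hnt : Nontrivial ρ.ker := by
      refine ⟨⟨⟨⟨η, hηR⟩, (AddMonoidHom.mem_ker).mpr ?_⟩, 0, fun h ↦ hη0 ?_⟩⟩
      · change res ((⟨η, hηR⟩ : R) : W.galH1) = 0
        exact hηres
      · exact congrArg (fun z : ρ.ker ↦ ((z : R) : W.galH1)) h
    exact Finite.one_lt_card_iff_nontrivial.mpr hnt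
  have hmapR : 2 * Nat.card (R.map res) ≤ A := by
    calc 2 * Nat.card (R.map res) ≤ Nat.card ρ.ker * Nat.card (R.map res) := Nat.mul_le_mul_right _ hker2
      _ = Nat.card R := hRsplit.symm
      _ ≤ A := hR
  -- ### `ker(δ|_Xs) ↪ res(R)`: invariant classes are restrictions
  have hkerle : Nat.card (δ.comp Xs.subtype).ker ≤ Nat.card (R.map res) := by
    refine Nat.card_le_card_of_injective (fun k ↦ (⟨((k : Xs) : (W.baseChange K).galH1), ?_⟩ : R.map res)) ?_
    · -- `δ k = 0` ⟹ `τ_* k = k` ⟹ `k = res b`, and `b ∈ R`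
      have hk : τs ((k : Xs) : (W.baseChange K).galH1) = ((k : Xs) : (W.baseChange K).galH1) := by
        have h := (AddMonoidHom.mem_ker).mp k.2
        change ((k : Xs) : (W.baseChange K).galH1) - τs ((k : Xs) : (W.baseChange K).galH1) = 0 at h
        exact (sub_eq_zero.mp h).symm
      obtain ⟨b, hb⟩ := exists_resBaseChange_eq_of_conjH1Points_eq_onHabitat W K hQ2 hcm hT v h2v hNv hmult hneg hIQ hodd h3 hHe hsq1 hsq2
        hρ Dt β ι d₁ M₀ hndiv hw hσ1 hk
      refine AddSubgroup.mem_map.mpr ⟨b, ?_, hb⟩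
      rw [hRdef, AddSubgroup.mem_comap]
      have hb' : res b = ((k : Xs) : (W.baseChange K).galH1) := hb
      rw [hb']
      exact (k : Xs).2
    · intro k₁ k₂ h
      apply Subtype.ext
      apply Subtype.ext
      exact congrArg (fun z : R.map res ↦ (z : (W.baseChange K).galH1)) h
  -- ### `#δ(Xs) ≤ B`
  have hrange : Nat.card (Xs.map δ) ≤ B := hA
  -- ### combine
  calc 2 * Nat.card X = 2 * (Nat.card (δ.comp Xs.subtype).ker * Nat.card (Xs.map δ)) := by rw [← hsplit, hcardXs]
    _ ≤ 2 * (Nat.card (R.map res) * B) := Nat.mul_le_mul_left 2 (Nat.mul_le_mul hkerle hrange)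
    _ = (2 * Nat.card (R.map res)) * B := by ring
    _ ≤ A * B := Nat.mul_le_mul_right B hmapR

/-- **SANDWICH′ FROM ITS TWO INPUTS (the numerical closer).**  On U_T's frame with `W.rootNumber = 1`, `σ ≠ 1` and an exponent `e ≤ 1`
(the memo's `DEF = ord₂ c(Wd)` of the minimal twin): if `#res⁻¹(X) ≤ #Ш(E/ℚ)[2^∞] · 2^e` (relaxed index, input (R)) and
`#(1 − τ_*)X ≤ 2^e` (anti-symmetrisation, input (A)), then **`#Ш(E/K)[2^∞] ∣ 2 · #Ш(E/ℚ)[2^∞]`** — literally the conclusion of the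
registered stub `stub_sandwichOfMinimalTwin` (LINE 19).  (`#X = 4^t` by gk2-p5 g29's
`exists_natCard_primaryComponent_sha_two_eq_pow_two_mul_onHabitat`; `#Ш(E/ℚ)[2^∞]` is `0` (excluded by the inequality) or a power of `2`.)
[cite: Kramer1981, Thm. 1 and proof of Thm. 2] [cite: GrossLMS1991, §5 (5.1)–(5.3)] -/
theorem natCard_sha_dvd_two_mul_of_inputs (hQ2 : KolyvaginRelationAtTwo) (hcm : ¬ W.HasCM)
    (hT : Odd W.tamagawaProduct) (v : HeightOneSpectrum (𝓞 ℚ)) (h2v : ((2 : ℕ) : 𝓞 ℚ) ∉ v.asIdeal)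
    (hNv : ((W.conductorNorm ℤ : ℕ) : 𝓞 ℚ) ∈ v.asIdeal) (hmult : W.HasMultiplicativeReductionAt v) (hneg : W.Δ < 0)
    (hIQ : IsImaginaryQuadratic K) (hodd : Odd (NumberField.discr K))
    (h3 : NumberField.discr K ≠ -3) (hHe : SatisfiesHeegnerHypothesis (W.conductorNorm ℤ) K)
    (hsq1 : ¬ IsSquare ((NumberField.discr K : ℚ) * -|W.Δ|)) (hsq2 : ¬ IsSquare ((NumberField.discr K : ℚ) * (-(2 * |W.Δ|))))
    (hρ : ∀ n : ℕ, 0 < n → W.HasSurjectiveModNGaloisRep ((2 : ℤ) ^ n))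
    (Dt : ModularParametrizationData W (W.conductorNorm ℤ)) (β : ℤ) (ι : K →+* ℂ) (d₁ : KolyvaginHeegnerData Dt β ι 1) (M₀ : ℕ)
    (hndiv : ¬ ∃ Q : (W.baseChange (ringClassField K ι 1)).toAffine.Point, ((2 ^ (M₀ + 1) : ℕ) : ℤ) • Q = d₁.derivedPoint)
    (hw : W.rootNumber = 1) {σ : K ≃ₐ[ℚ] K} (hσ1 : σ ≠ 1) (e : ℕ) (he : e ≤ 1)
    (hR : Nat.card (((AddCommGroup.primaryComponent (↥(W.baseChange K).sha) 2).map (W.baseChange K).sha.subtype).comap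
      (resBaseChange W K)) ≤ Nat.card (AddCommGroup.primaryComponent (↥W.sha) 2) * 2 ^ e)
    (hA : Nat.card (((AddCommGroup.primaryComponent (↥(W.baseChange K).sha) 2).map (W.baseChange K).sha.subtype).map
      (AddMonoidHom.id (W.baseChange K).galH1 - (isLiftOfAut_liftAut σ).conjH1Points W)) ≤ 2 ^ e) :
    Nat.card (AddCommGroup.primaryComponent (↥(W.baseChange K).sha) 2) ∣
      2 * Nat.card (AddCommGroup.primaryComponent (↥W.sha) 2) := by
  haveI : Fact (Nat.Prime 2) := ⟨Nat.prime_two⟩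
  have h := two_mul_natCard_sha_le_of_inputs W K hQ2 hcm hT v h2v hNv hmult hneg hIQ hodd h3 hHe hsq1 hsq2 hρ Dt β ι d₁ M₀ hndiv
    hw hσ1 _ _ hR hA
  obtain ⟨t, ht⟩ := exists_natCard_primaryComponent_sha_two_eq_pow_two_mul_onHabitat hQ2 W hcm hT v h2v hNv hmult hneg K hIQ
    hodd h3 hHe hsq1 hsq2 hρ Dt β ι d₁ M₀ hndiv
  have h4 : 2 ^ e * 2 ^ e ≤ 4 := by interval_cases e <;> norm_num
  have hle : 2 * 2 ^ (2 * t) ≤ Nat.card (AddCommGroup.primaryComponent (↥W.sha) 2) * 4 := by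
    calc 2 * 2 ^ (2 * t) ≤ Nat.card (AddCommGroup.primaryComponent (↥W.sha) 2) * 2 ^ e * 2 ^ e := by rw [← ht]; exact h
      _ = Nat.card (AddCommGroup.primaryComponent (↥W.sha) 2) * (2 ^ e * 2 ^ e) := by ring
      _ ≤ Nat.card (AddCommGroup.primaryComponent (↥W.sha) 2) * 4 := Nat.mul_le_mul_left _ h4
  have hle' : 2 ^ (2 * t) ≤ 2 * Nat.card (AddCommGroup.primaryComponent (↥W.sha) 2) := by omega
  rw [ht]
  by_cases hY0 : Nat.card (AddCommGroup.primaryComponent (↥W.sha) 2) = 0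
  · exfalso
    have hpos : 0 < 2 ^ (2 * t) := Nat.pos_of_ne_zero (pow_ne_zero _ two_ne_zero)
    omega
  · haveI : Finite (AddCommGroup.primaryComponent (↥W.sha) 2) := Nat.finite_of_card_ne_zero hY0
    obtain ⟨k, hk⟩ := exists_natCard_addPrimaryComponent_eq_pow (A := ↥W.sha) 2
    rw [hk] at hle' ⊢
    have hkt : 2 * t ≤ k + 1 := by
      have h2 : 2 ^ (2 * t) ≤ 2 ^ (k + 1) := by rw [pow_succ]; omega
      exact (Nat.pow_le_pow_iff_right (by norm_num)).mp h2
    calc 2 ^ (2 * t) ∣ 2 ^ (k + 1) := pow_dvd_pow 2 hkt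
      _ = 2 * 2 ^ k := by ring

end Assembly

end Summit.BirchSwinnertonDyer.BirchSwinnertonDyer.Theorems.GenusExact.PlusDescent

end
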